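import Literature.Geometry.Lorentzian.RicciVariationConformalTerm
import Literature.Geometry.Lorentzian.RicciVariationEllipticSteps
import HarnessLib

/-!
# The derivative of the mass integral along `ds²_t = ds² + t Ric` (Schoen–Yau 1979,
# (3.27)–(3.30)): step `hd` of positive mass rigidity

Schoen–Yau, Comm. Math. Phys. 65 (1979), p. 73: the mass of the scalar-flat metric `φ_t⁴ ds²_t`
is `M(t) = −c ∫_N R_t φ_t √g_t dx` (3.27), and *"(3.27)–(3.29): the estimates hold uniformly for
`t` small, so `M(t)` is differentiable at `0` with `M'(0) = −c ∫_N R'₀ √g dx`"* (3.30). This file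
**proves** that differentiation under the integral sign, in the form of the hypothesis `hd` of
`exists_ricciVariation_negativeMass_of_massZero_of_elliptic_steps`
(`RicciVariationEllipticSteps.lean`):

* `AFEnd.hasDerivAt_integral_scalarCurvature_mul_conformalFactor` — for data `D` with `R(h) ≡ 0`,
  `h − δ = o₅(r⁻²)` on the only end, a family `D_t` with metric `h + t Ric(h)` (`|t| < τ`),
  pointwise derivatives `R'(x)` of `t ↦ R_t(x)` at `0`, and positive factors `φ_t` with
  `φ_t⁴ h_t` scalar flat and asymptotically Schwarzschildean, the function
  `t ↦ ∫ R_t φ_t dV_t` has derivative `∫ R' dV_h` at `t = 0`;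
* `ricciVariation_massIntegral_hasDerivAt` — the same, packaged verbatim as the closed hypothesis
  `hd` of the elliptic-steps reduction;
* `exists_ricciVariation_negativeMass_of_massZero_of_lemma33_family` — hence the named fact
  `exists_ricciVariation_negativeMass_of_massZero` follows from the remaining step `hc` alone
  (Lemma 3.3 along the family).

Proof: `∫ R_t φ_t dV_t = ∫ R_t dV_t + ∫ R_t (φ_t − 1) dV_t`. The second term is `O(t²)`
(`exists_bound_integral_scalarCurvature_mul_conformalFactor_sub_one`,
`RicciVariationConformalTerm.lean`). For the first, `dV_t = ρ_t dV_h` with a continuous density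
`(1 − |t|C)^{3/2} ≤ ρ_t ≤ (1 + |t|C)^{3/2}` (`riemannianMeasure_ricciFamily_eq_withDensity`), and
`|R_t/t| ρ_t ≤ 2K (1 + ‖coord‖)⁻⁴ ∈ L¹` (`exists_abs_scalarCurvature_ricciFamily_sub_le`,
`integrable_one_add_norm_coord_rpow_neg`) with `R_t(x)/t → R'(x)` and `ρ_t(x) → 1`, so dominated
convergence applies. All results are proved; no definitions, no named facts.

## References

* R. Schoen, S.-T. Yau, Comm. Math. Phys. 65 (1979) 45–76, §3, (3.27)–(3.30) (p. 73).
-/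

noncomputable section

open Set Function Filter Metric Bornology Asymptotics MeasureTheory Measure TopologicalSpace
  Manifold Bundle
open scoped Topology Manifold ContDiff ENNReal

namespace Literature.Geometry.Lorentzian

open Literature.Geometry.Riemannian PseudoRiemannianMetric

namespace AFEnd

variable {X : Type} [TopologicalSpace X] [ChartedSpace E3 X] [IsManifold (𝓡 3) ∞ X]
  [T2Space X] [SecondCountableTopology X] [LocallyCompactSpace X] [ConnectedSpace X]
  [MeasurableSpace X] [BorelSpace X]
  (e : AFEnd X) (D : InitialDataSet (𝓡 3) X)

omit [T2Space X] [SecondCountableTopology X] [LocallyCompactSpace X] [ConnectedSpace X]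
  [MeasurableSpace X] [BorelSpace X] in
/-- The scalar curvatures of the family are continuous. [folklore] -/
private theorem continuous_scalarCurvatureFn'' (D₂ : InitialDataSet (𝓡 3) X) :
    Continuous D₂.scalarCurvatureFn := by
  haveI := D₂.metric.hasLeviCivita
  exact D₂.metric.contMDiff_scalarCurvature.continuous.congr fun x ↦ (D₂.scalarCurvatureFn_eq x).symm

set_option maxHeartbeats 800000 in
-- a long measure-theoretic assembly
/-- **`d/dt|₀ ∫ R_t φ_t dV_t = ∫ R'₀ dV_h`** (Schoen–Yau 1979, (3.27)–(3.30): *"the estimates hold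
uniformly for `t` small, so `M(t)` is differentiable at `0` with `M'(0) = −c ∫ R'₀ √g dx`"*).
Hypotheses as in step `hd` of `exists_ricciVariation_negativeMass_of_massZero_of_elliptic_steps`:
`R(h) ≡ 0`, `h − δ = o₅(r⁻²)` on the only end, `h_t = h + t Ric(h)` for `|t| < τ`, pointwise
derivatives `R'` of `R_t` at `0`, and positive `φ_t` with `φ_t⁴ h_t` scalar flat and
asymptotically Schwarzschildean. Proof in the module docstring (split off the conformal term,
dominated convergence against `dV_t = ρ_t dV_h`). [cite: SchoenYauPMT1979, (3.27)–(3.30) (p. 73)] -/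
theorem hasDerivAt_integral_scalarCurvature_mul_conformalFactor [D.metric.HasLeviCivita]
    (haf : e.IsStronglyAsymptoticallyFlatWith D 0 2 0 5 0) (hsole : e.IsSoleEnd)
    (hR0 : ∀ x : X, D.metric.scalarCurvature x = 0) {τ : ℝ} (hτ : 0 < τ)
    (Dt : ℝ → InitialDataSet (𝓡 3) X)
    (hval : ∀ t : ℝ, |t| < τ → ∀ (x : X) (v w : TangentSpace (𝓡 3) x),
      (Dt t).metric.val x v w = D.metric.val x v w + t * D.metric.ricci x v w)
    (R' : X → ℝ) (hR' : ∀ x : X, HasDerivAt (fun t ↦ (Dt t).scalarCurvatureFn x) (R' x) 0)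
    (φ : ℝ → X → ℝ) (D' : ℝ → InitialDataSet (𝓡 3) X) (m : ℝ → ℝ)
    (hsteps : ∀ t : ℝ, |t| < τ →
      (∀ x, 0 < φ t x) ∧
      (∀ (x : X) (v w : TangentSpace (𝓡 3) x),
        (D' t).metric.val x v w = φ t x ^ 4 * (Dt t).metric.val x v w) ∧
      (∀ x, (D' t).scalarCurvatureFn x = 0) ∧
      IsAsymptoticallySchwarzschild e (D' t) (m t) 2) :
    HasDerivAt (fun t ↦ ∫ x, (Dt t).scalarCurvatureFn x * φ t x ∂riemannianMeasure (Dt t).h)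
      (∫ x, R' x ∂riemannianMeasure D.h) 0 := by
  set μ : Measure X := riemannianMeasure D.h with hμ
  -- constants
  obtain ⟨τ₁, C, c₁, hτ₁, hτ₁τ, hC0, hτ₁C, -, hC, hunif⟩ :=
    e.exists_uniform_constants_ricciFamily D haf hsole hτ Dt hval
  obtain ⟨τ₂, K, hτ₂, hτ₂τ, hK0, hglob⟩ :=
    e.exists_abs_scalarCurvature_ricciFamily_sub_le D haf hsole hτ Dt hval
  obtain ⟨τ₄, C_B, hτ₄, hτ₄τ, hCB0, hB⟩ :=
    e.exists_bound_integral_scalarCurvature_mul_conformalFactor_sub_one D haf hsole hR0 hτ Dt hval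
      φ D' m hsteps
  have hAF : e.IsMetricAsymptoticallyFlat D 2 :=
    AFEnd.IsStronglyAsymptoticallyFlatWith.isMetricAsymptoticallyFlat_of_massZero e D haf
      (by norm_num)
  set τ₅ : ℝ := min τ₁ (min τ₂ τ₄) with hτ₅
  have hτ₅0 : 0 < τ₅ := lt_min hτ₁ (lt_min hτ₂ hτ₄)
  -- notation
  set R : ℝ → X → ℝ := fun t x ↦ (Dt t).scalarCurvatureFn x with hR
  set dens : ℝ → X → ℝ := fun t p ↦ Real.sqrt (LinearMap.det
    ((D.metric.sharp p).toLinearMap ∘ₗ (Dt t).metric.toBilinForm p)) with hdens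
  set W : X → ℝ := fun x ↦ (1 + ‖e.coord x‖) ^ (-4 : ℝ) with hW
  have hW0 : ∀ x, 0 ≤ W x := fun x ↦ Real.rpow_nonneg (by positivity) _
  have hWi : Integrable W μ := e.integrable_one_add_norm_coord_rpow_neg D two_pos hAF hsole (by norm_num)
  -- `R_0 = R(h) = 0`
  have hR00 : D.scalarCurvatureFn = fun _ ↦ 0 := by
    funext x
    rw [D.scalarCurvatureFn_eq]
    exact hR0 x
  have hRzero : R 0 = fun _ ↦ 0 := by
    have h : (Dt 0).scalarCurvatureFn = D.scalarCurvatureFn :=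
      InitialDataSet.scalarCurvatureFn_congr fun x v w ↦ by rw [hval 0 (by simpa using hτ)]; ring
    simp only [hR]
    rw [show (fun x ↦ (Dt 0).scalarCurvatureFn x) = (Dt 0).scalarCurvatureFn from rfl, h, hR00]
  have hRle : ∀ t, |t| < τ₂ → ∀ x, |R t x| ≤ |t| * K * W x := fun t ht x ↦ by
    have h := hglob t ht x
    rw [hR00, sub_zero] at h
    exact h
  -- facts for `|t| < τ₅`
  have hfacts : ∀ t : ℝ, |t| < τ₅ →
      riemannianMeasure (Dt t).h = μ.withDensity (fun p ↦ ENNReal.ofReal (dens t p)) ∧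
      Continuous (dens t) ∧ (∀ p, Real.sqrt ((1 - |t| * C) ^ 3) ≤ dens t p ∧
        dens t p ≤ Real.sqrt ((1 + |t| * C) ^ 3)) ∧ (∀ p, dens t p ≤ 2) ∧
      Integrable (R t) (riemannianMeasure (Dt t).h) ∧
      Integrable (fun x ↦ R t x * (φ t x - 1)) (riemannianMeasure (Dt t).h) ∧
      |∫ x, R t x * (φ t x - 1) ∂riemannianMeasure (Dt t).h| ≤ C_B * t ^ 2 := by
    intro t ht
    have ht₁ : |t| < τ₁ := ht.trans_le (min_le_left _ _)
    have ht₂ : |t| < τ₂ := ht.trans_le ((min_le_right _ _).trans (min_le_left _ _))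
    have ht₄ : |t| < τ₄ := ht.trans_le ((min_le_right _ _).trans (min_le_right _ _))
    have htτ : |t| < τ := ht₁.trans_le hτ₁τ
    have htC : |t| * C ≤ 1 / 2 := (mul_le_mul_of_nonneg_right ht₁.le hC0).trans hτ₁C
    have htC1 : |t| * C ≤ 1 := htC.trans (by norm_num)
    obtain ⟨hdens_eq, hdens_c, hdet⟩ :=
      riemannianMeasure_ricciFamily_eq_withDensity D hC htC1 (hval t htτ)
    obtain ⟨-, -, -, hμle, -, -⟩ := hunif t ht₁
    obtain ⟨hBi, hBle⟩ := hB t ht₄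
    have hbounds : ∀ p, Real.sqrt ((1 - |t| * C) ^ 3) ≤ dens t p ∧
        dens t p ≤ Real.sqrt ((1 + |t| * C) ^ 3) := fun p ↦
      ⟨Real.sqrt_le_sqrt (hdet p).1, Real.sqrt_le_sqrt (hdet p).2⟩
    have h2 : ∀ p, dens t p ≤ 2 := fun p ↦ by
      refine (hbounds p).2.trans ?_
      rw [show (2 : ℝ) = Real.sqrt 4 by rw [show (4 : ℝ) = 2 ^ 2 by norm_num, Real.sqrt_sq two_pos.le]]
      refine Real.sqrt_le_sqrt ?_
      have h1 : 1 + |t| * C ≤ 3 / 2 := by linarith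
      have h0 : 0 ≤ 1 + |t| * C := by positivity
      nlinarith [pow_le_pow_left₀ h0 h1 3]
    have hRi : Integrable (R t) (riemannianMeasure (Dt t).h) := by
      have hWt : Integrable W (riemannianMeasure (Dt t).h) :=
        e.integrable_one_add_norm_coord_rpow_neg_of_le D two_pos hAF hsole (by norm_num) hμle
      refine (hWt.const_mul (|t| * K)).mono' (continuous_scalarCurvatureFn'' (Dt t)).aestronglyMeasurable
        (Eventually.of_forall fun x ↦ ?_)
      rw [Real.norm_eq_abs]
      exact hRle t ht₂ x
    exact ⟨hdens_eq, hdens_c, hbounds, h2, hRi, hBi, hBle⟩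
  -- the function and its value at `0`
  set I : ℝ → ℝ := fun t ↦ ∫ x, R t x * φ t x ∂riemannianMeasure (Dt t).h with hI
  have hI0 : I 0 = 0 := by
    simp only [hI, hRzero, zero_mul, integral_zero]
  -- the main term `A t = ∫ t⁻¹ R_t ρ_t dV` and its limit (dominated convergence)
  set F : ℝ → X → ℝ := fun t x ↦ t⁻¹ * R t x * dens t x with hF
  have hS : {t : ℝ | |t| < τ₅} ∈ 𝓝[≠] (0 : ℝ) := by
    refine mem_nhdsWithin_of_mem_nhds ?_
    have : {t : ℝ | |t| < τ₅} = Metric.ball 0 τ₅ := by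
      ext t
      simp
    rw [this]
    exact Metric.ball_mem_nhds 0 hτ₅0
  have hA : Tendsto (fun t ↦ ∫ x, F t x ∂μ) (𝓝[≠] 0) (𝓝 (∫ x, R' x ∂μ)) := by
    refine tendsto_integral_filter_of_dominated_convergence (fun x ↦ 2 * K * W x) ?_ ?_
      (hWi.const_mul (2 * K)) ?_
    · filter_upwards [hS] with t ht
      obtain ⟨-, hdc, -⟩ := hfacts t ht
      exact ((continuous_const.mul (continuous_scalarCurvatureFn'' (Dt t))).mul hdc).aestronglyMeasurable
    · filter_upwards [hS, self_mem_nhdsWithin] with t ht ht0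
      obtain ⟨-, -, hbd, h2, -⟩ := hfacts t ht
      have ht₂ : |t| < τ₂ := ht.trans_le ((min_le_right _ _).trans (min_le_left _ _))
      refine Eventually.of_forall fun x ↦ ?_
      have hd0 : 0 ≤ dens t x := Real.sqrt_nonneg _
      rw [Real.norm_eq_abs, hF]
      simp only
      rw [abs_mul, abs_mul, abs_inv, abs_of_nonneg hd0]
      have ht0' : 0 < |t| := abs_pos.2 ht0
      calc |t|⁻¹ * |R t x| * dens t x ≤ |t|⁻¹ * (|t| * K * W x) * 2 :=
            mul_le_mul (mul_le_mul_of_nonneg_left (hRle t ht₂ x) (inv_nonneg.2 ht0'.le)) (h2 x) hd0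
              (by positivity)
        _ = 2 * K * W x := by field_simp
    · refine Eventually.of_forall fun x ↦ ?_
      -- `t⁻¹ R_t(x) → R'(x)` and `ρ_t(x) → 1`
      have h1 : Tendsto (fun t ↦ t⁻¹ * R t x) (𝓝[≠] 0) (𝓝 (R' x)) := by
        have h := hasDerivAt_iff_tendsto_slope.1 (hR' x)
        refine h.congr' ?_
        filter_upwards [self_mem_nhdsWithin] with t ht
        rw [slope_def_field, sub_zero]
        have : R 0 x = 0 := by rw [hRzero]
        simp only [hR] at this ⊢
        rw [this, sub_zero, div_eq_inv_mul]
      have h2 : Tendsto (fun t ↦ dens t x) (𝓝[≠] 0) (𝓝 1) := by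
        have hlo : Tendsto (fun t : ℝ ↦ Real.sqrt ((1 - |t| * C) ^ 3)) (𝓝[≠] 0) (𝓝 1) := by
          have hc : Continuous fun t : ℝ ↦ Real.sqrt ((1 - |t| * C) ^ 3) := by fun_prop
          have := hc.tendsto 0
          simp only [abs_zero, zero_mul, sub_zero, one_pow, Real.sqrt_one] at this
          exact this.mono_left nhdsWithin_le_nhds
        have hhi : Tendsto (fun t : ℝ ↦ Real.sqrt ((1 + |t| * C) ^ 3)) (𝓝[≠] 0) (𝓝 1) := by
          have hc : Continuous fun t : ℝ ↦ Real.sqrt ((1 + |t| * C) ^ 3) := by fun_prop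
          have := hc.tendsto 0
          simp only [abs_zero, zero_mul, add_zero, one_pow, Real.sqrt_one] at this
          exact this.mono_left nhdsWithin_le_nhds
        refine tendsto_of_tendsto_of_tendsto_of_le_of_le' hlo hhi ?_ ?_
        · filter_upwards [hS] with t ht
          exact ((hfacts t ht).2.2.1 x).1
        · filter_upwards [hS] with t ht
          exact ((hfacts t ht).2.2.1 x).2
      have h := h1.mul h2
      rw [mul_one] at h
      simpa only [hF] using h
  -- the conformal term `t⁻¹ ∫ R_t (φ_t − 1) dV_t → 0`
  have hBt : Tendsto (fun t ↦ t⁻¹ * ∫ x, R t x * (φ t x - 1) ∂riemannianMeasure (Dt t).h)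
      (𝓝[≠] 0) (𝓝 0) := by
    have hbound : ∀ᶠ t in 𝓝[≠] (0 : ℝ),
        |t⁻¹ * ∫ x, R t x * (φ t x - 1) ∂riemannianMeasure (Dt t).h| ≤ C_B * |t| := by
      filter_upwards [hS, self_mem_nhdsWithin] with t ht ht0
      obtain ⟨-, -, -, -, -, -, hBle⟩ := hfacts t ht
      have ht0' : 0 < |t| := abs_pos.2 ht0
      rw [abs_mul, abs_inv]
      calc |t|⁻¹ * |∫ x, R t x * (φ t x - 1) ∂riemannianMeasure (Dt t).h| ≤ |t|⁻¹ * (C_B * t ^ 2) :=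
            mul_le_mul_of_nonneg_left hBle (inv_nonneg.2 ht0'.le)
        _ = C_B * |t| := by rw [← sq_abs]; field_simp
    have hlim : Tendsto (fun t : ℝ ↦ C_B * |t|) (𝓝[≠] 0) (𝓝 0) := by
      have hc : Continuous fun t : ℝ ↦ C_B * |t| := by fun_prop
      have := hc.tendsto 0
      simp only [abs_zero, mul_zero] at this
      exact this.mono_left nhdsWithin_le_nhds
    exact squeeze_zero_norm' (by simpa only [Real.norm_eq_abs] using hbound) hlim
  -- the slope of `I` at `0` is `A t + t⁻¹ B t` near `0`
  have hslope : slope I 0 =ᶠ[𝓝[≠] 0]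
      fun t ↦ ∫ x, F t x ∂μ + t⁻¹ * ∫ x, R t x * (φ t x - 1) ∂riemannianMeasure (Dt t).h := by
    filter_upwards [hS, self_mem_nhdsWithin] with t ht ht0
    obtain ⟨hdens_eq, hdens_c, -, h2, hRi, hBi, -⟩ := hfacts t ht
    rw [slope_def_field, sub_zero, hI0, sub_zero]
    simp only [hI]
    -- split `R φ = R + R (φ − 1)`
    have hsplit : ∫ x, R t x * φ t x ∂riemannianMeasure (Dt t).h =
        ∫ x, R t x ∂riemannianMeasure (Dt t).h +
          ∫ x, R t x * (φ t x - 1) ∂riemannianMeasure (Dt t).h := by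
      rw [← integral_add hRi hBi]
      refine integral_congr_ae (Eventually.of_forall fun x ↦ ?_)
      ring
    -- `∫ R_t dV_t = ∫ R_t ρ_t dV`
    have hwd : ∫ x, R t x ∂riemannianMeasure (Dt t).h = ∫ x, R t x * dens t x ∂μ := by
      rw [hdens_eq, integral_withDensity_eq_integral_toReal_smul (f := fun p ↦ ENNReal.ofReal (dens t p))
        (ENNReal.measurable_ofReal.comp hdens_c.measurable) (Eventually.of_forall fun x ↦
          ENNReal.ofReal_lt_top)]
      refine integral_congr_ae (Eventually.of_forall fun x ↦ ?_)
      simp only [smul_eq_mul]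
      rw [ENNReal.toReal_ofReal (Real.sqrt_nonneg _), mul_comm]
    rw [hsplit, hwd, add_div]
    congr 1
    · rw [div_eq_inv_mul, ← integral_const_mul]
      refine integral_congr_ae (Eventually.of_forall fun x ↦ ?_)
      simp only [hF]
      ring
    · rw [div_eq_inv_mul]
  -- conclusion
  rw [hasDerivAt_iff_tendsto_slope]
  refine (Tendsto.congr' hslope.symm ?_)
  have h := hA.add hBt
  rw [add_zero] at h
  exact h

end AFEnd

/-- **Step `hd` of `exists_ricciVariation_negativeMass_of_massZero_of_elliptic_steps`, proved**
(Schoen–Yau 1979, (3.27)–(3.30)): the verbatim closed hypothesis `hd` of the elliptic-steps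
reduction (`RicciVariationEllipticSteps.lean`) — for every one-ended asymptotically flat `X`, data
`D` with `R ≡ 0`, family `D_t` with metric `h + t Ric`, pointwise derivatives `R'` and recorded
Lemma 3.3 outputs `φ_t, D'_t, m(t)`, the mass integral `t ↦ ∫ R_t φ_t dV_t` has derivative
`∫ R' dV_h` at `0` (`AFEnd.hasDerivAt_integral_scalarCurvature_mul_conformalFactor`).
[cite: SchoenYauPMT1979, (3.27)–(3.30) (p. 73)] -/
theorem ricciVariation_massIntegral_hasDerivAt :
    ∀ (X : Type) [TopologicalSpace X] [ChartedSpace E3 X] [IsManifold (𝓡 3) ∞ X] [T2Space X]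
      [SecondCountableTopology X] [LocallyCompactSpace X] [ConnectedSpace X] [MeasurableSpace X]
      [BorelSpace X] (D : InitialDataSet (𝓡 3) X) [D.metric.HasLeviCivita] (e : AFEnd X) (τ : ℝ)
      (Dt : ℝ → InitialDataSet (𝓡 3) X) (R' : X → ℝ) (φ : ℝ → X → ℝ)
      (D' : ℝ → InitialDataSet (𝓡 3) X) (m : ℝ → ℝ),
      Literature.Topology.FourManifolds.IsOrientable (𝓡 3) X →
      e.IsStronglyAsymptoticallyFlatWith D 0 2 0 5 0 → e.IsSoleEnd →
      (∀ x : X, D.metric.scalarCurvature x = 0) → 0 < τ →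
      (∀ t : ℝ, |t| < τ → ∀ (x : X) (v w : TangentSpace (𝓡 3) x),
        (Dt t).metric.val x v w = D.metric.val x v w + t * D.metric.ricci x v w) →
      (∀ x : X, HasDerivAt (fun t ↦ (Dt t).scalarCurvatureFn x) (R' x) 0) →
      (∀ t : ℝ, |t| < τ →
        (∀ x, 0 < φ t x) ∧
        (∀ (x : X) (v w : TangentSpace (𝓡 3) x),
          (D' t).metric.val x v w = φ t x ^ 4 * (Dt t).metric.val x v w) ∧
        (∀ x, (D' t).scalarCurvatureFn x = 0) ∧
        IsAsymptoticallySchwarzschild e (D' t) (m t) 2) →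
      HasDerivAt (fun t ↦ ∫ x, (Dt t).scalarCurvatureFn x * φ t x ∂riemannianMeasure (Dt t).h)
        (∫ x, R' x ∂riemannianMeasure D.h) 0 := by
  intro X _ _ _ _ _ _ _ _ _ D _ e τ Dt R' φ D' m _ haf hsole hR0 hτ hval hR' hsteps
  exact e.hasDerivAt_integral_scalarCurvature_mul_conformalFactor D haf hsole hR0 hτ Dt hval R' hR'
    φ D' m hsteps

/-- **Step 2 of positive mass rigidity from Lemma 3.3 along the family alone.** With `hd` proved
(`ricciVariation_massIntegral_hasDerivAt`), the named fact
`exists_ricciVariation_negativeMass_of_massZero` (Schoen–Yau 1979, Thm. 2 ⇒ `Ric ≡ 0`, pp. 72–74)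
follows from the single remaining elliptic step `hc` of
`exists_ricciVariation_negativeMass_of_massZero_of_elliptic_steps` — Lemma 3.3 applied to the
metrics `ds²_t = ds² + t Ric` for `t` small (existence of the scalar-flat conformal factor
`φ_t = 1 + v_t` by Lemma 3.2, its mass formula and uniqueness), stated verbatim as there.
[cite: SchoenYauPMT1979, §3, Lemma 3.3 and (3.26)–(3.30) (pp. 71–74)] -/
theorem exists_ricciVariation_negativeMass_of_massZero_of_lemma33_family
    (hc :
      ∃ c₁ : ℝ, 0 < c₁ ∧
      ∀ (X : Type) [TopologicalSpace X] [ChartedSpace E3 X] [IsManifold (𝓡 3) ∞ X] [T2Space X]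
        [SecondCountableTopology X] [LocallyCompactSpace X] [ConnectedSpace X]
        [MeasurableSpace X] [BorelSpace X]
        (D : InitialDataSet (𝓡 3) X) [D.metric.HasLeviCivita] (e : AFEnd X) (τ : ℝ)
        (Dt : ℝ → InitialDataSet (𝓡 3) X),
        Literature.Topology.FourManifolds.IsOrientable (𝓡 3) X →
        e.IsStronglyAsymptoticallyFlatWith D 0 2 0 5 0 → e.IsSoleEnd →
        (∀ x : X, D.metric.scalarCurvature x = 0) → 0 < τ →
        (∀ t : ℝ, |t| < τ → ∀ (x : X) (v w : TangentSpace (𝓡 3) x),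
          (Dt t).metric.val x v w = D.metric.val x v w + t * D.metric.ricci x v w) →
        ∃ (τ' : ℝ) (φ : ℝ → X → ℝ) (D' : ℝ → InitialDataSet (𝓡 3) X), 0 < τ' ∧ τ' ≤ τ ∧
          ∀ t : ℝ, |t| < τ' →
            (∀ x : X, 0 < φ t x) ∧
            (∀ (x : X) (v w : TangentSpace (𝓡 3) x),
              (D' t).metric.val x v w = φ t x ^ 4 * (Dt t).metric.val x v w) ∧
            (∀ x : X, (D' t).scalarCurvatureFn x = 0) ∧
            Integrable (fun x ↦ (Dt t).scalarCurvatureFn x * φ t x) (riemannianMeasure (Dt t).h) ∧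
            IsAsymptoticallySchwarzschild e (D' t)
              (-c₁ * ∫ x, (Dt t).scalarCurvatureFn x * φ t x ∂(riemannianMeasure (Dt t).h)) 2 ∧
            (∀ (ψ : X → ℝ) (D'' : InitialDataSet (𝓡 3) X) (m : ℝ),
              (∀ x : X, 0 < ψ x) →
              (∀ (x : X) (v w : TangentSpace (𝓡 3) x),
                D''.metric.val x v w = ψ x ^ 4 * (Dt t).metric.val x v w) →
              (∀ x : X, D''.scalarCurvatureFn x = 0) →
              IsAsymptoticallySchwarzschild e D'' m 2 → ψ = φ t)) :
    exists_ricciVariation_negativeMass_of_massZero :=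
  exists_ricciVariation_negativeMass_of_massZero_of_elliptic_steps hc
    ricciVariation_massIntegral_hasDerivAt

end Literature.Geometry.Lorentzian

end
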